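import Literature.NumberTheory.Rogawski1990.UnitFundamentalLemmaExplicitOfIsUnit       -- ★ p862604 `unitFundamentalLemmaExplicit_of_isUnit` ([Rogawski1990 Prop. 4.9.1 (b)] off a finite set, `IsUnit H′`)
import Summits.HodgeConjecture.HodgeConjecture.Theorems.F0P3cStCharTSCharField        -- ★ `qsForm_map_cmConjRingHom_transpose`, ★ `det_qsForm_ne_zero`
import HarnessLib

/-!
# R90-TF · S10 (Ch. 13.5–13.8 comparison) — the explicit unit fundamental lemma «off a finite set» AT S10's FRAME `H′ := Φ₃ = qsForm L`

Cell `hodgecm-mathlib`, crux H413 (`stmt-HodgeConjecture-24833`, lane `--supports`, helper), route of record `HCCMUnconditional` (count-neutral).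
Programme R90-TF, section S10 = Ch. 13.5–13.8 (base `R90-C138`), dealer R90-C138-plan (g0) DEAL 22:38:54Z «THE 10-MINUTE BRICK» → seat R90-C131-p03 (g0)
(S10 PEN); junction J-A2c-2 (memo `R90/R90-C131-p03/g0/S10/MEMO-A2c-unitFL-currency.md`).  ONE THEOREM, no `def`, no instance, no `sorry`.

MATHEMATICS.  ★ `unitFundamentalLemmaExplicit_of_isUnit` is [Rogawski1990, §4.9 Prop. 4.9.1 (b) p. 55] for every INVERTIBLE hermitian `H′`: a finite `S_bad`
outside which `1_{K_{H,v}}` is a `Δ‴_v`-transfer of `1_{K′_v}` for canonical families and mass-one Haar measures (★ `UnitFundamentalLemmaExplicit`).  The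
quasi-split form `Φ₃ = qsForm L` of the comparison [§13.8 p. 219 L2 «f^{u,v′} is the unit of a hyperspecial …»] is hermitian (★ `qsForm_map_cmConjRingHom_transpose`)
with `det Φ₃ = −1 ≠ 0` (★ `det_qsForm_ne_zero`), so the letter holds at S10's frame `Gqs L v = U(Φ₃)(L⁺_v)` — the name the A2c payer sheet cites.
[cite: Rogawski1990, §4.9 Prop. 4.9.1 (b) p. 55; §12.2 p. 173; §13.8 p. 219]
HONEST LABEL: an instantiated letter; pays no socket by itself (A2c's per-place `htrf` at dyadic inert `w` still meets the `2`-adic guard, J-A2c-2); HC_CM is proved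
only modulo the 7 printed citations (2 remaining named inputs: hLiu418 = stmt-HodgeConjecture-24832, h413 = stmt-HodgeConjecture-24833) until rung 0 closes.
-/

set_option autoImplicit false
set_option linter.dupNamespace false

noncomputable section

open NumberField IsDedekindDomain MeasureTheory Measure
open Literature.NumberTheory.Rogawski1990 Literature.NumberTheory.Automorphic Literature.NumberTheory.GaloisRepresentations
open Summit.HodgeConjecture.HodgeConjecture.Cruxes.H413.F0P3cStCharTSCharField (qsForm_map_cmConjRingHom_transpose det_qsForm_ne_zero)
open scoped Matrix MatrixGroups

namespace Summit.HodgeConjecture.HodgeConjecture.R90.S10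

/-- **[Rogawski1990 Prop. 4.9.1 (b)] AT S10's FRAME: the explicit unit fundamental lemma off a finite set for `H′ := Φ₃ = qsForm L`.**  For a CM field `L`, a unitary
Hecke character `μ` of `L` with `μ|_{𝕀_{L⁺}} = ω_{L∕L⁺}`, Haar measures `νH_v` on `H_v = U(Φ₂) × U(Φ₁)(L⁺_v)` and `νG_v` on `Gqs L v = U(Φ₃)(L⁺_v)`, and arbitrary Borel
σ-algebras on the orbit spaces: ★ `UnitFundamentalLemmaExplicit L (qsForm L) μ νH νG` (a finite `S_bad` off which, under the mass-one normalisations, every canonical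
pair `(mH, mG)` satisfies ★ `IsLocalUnitTransfer L (qsForm L) v Δ‴_v mH mG`).  Term: ★ `unitFundamentalLemmaExplicit_of_isUnit` at ★ `det_qsForm_ne_zero`,
★ `qsForm_map_cmConjRingHom_transpose`. [cite: Rogawski1990, §4.9 Prop. 4.9.1 (b) p. 55; §12.2 p. 173] -/
theorem unitFundamentalLemmaExplicit_qsForm (L : Type) [Field L] [NumberField L] [IsCMField L] (μ : HeckeCharacter L)
    [∀ v : HeightOneSpectrum (𝓞 ↥(maximalRealSubfield L)),
      MeasurableSpace ((UnitaryGroup.cmDatum L 2 (Matrix.of fun i j : Fin 2 => if i.val + j.val + 1 = 2 then (1 : L) else 0)).Local v ×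
        (UnitaryGroup.cmDatum L 1 (Matrix.of fun i j : Fin 1 => if i.val + j.val + 1 = 1 then (1 : L) else 0)).Local v)]
    [∀ v : HeightOneSpectrum (𝓞 ↥(maximalRealSubfield L)),
      BorelSpace ((UnitaryGroup.cmDatum L 2 (Matrix.of fun i j : Fin 2 => if i.val + j.val + 1 = 2 then (1 : L) else 0)).Local v ×
        (UnitaryGroup.cmDatum L 1 (Matrix.of fun i j : Fin 1 => if i.val + j.val + 1 = 1 then (1 : L) else 0)).Local v)]
    [∀ v : HeightOneSpectrum (𝓞 ↥(maximalRealSubfield L)), MeasurableSpace ((UnitaryGroup.cmDatum L 3 (qsForm L)).Local v)]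
    [∀ v : HeightOneSpectrum (𝓞 ↥(maximalRealSubfield L)), BorelSpace ((UnitaryGroup.cmDatum L 3 (qsForm L)).Local v)]
    (νH : ∀ v : HeightOneSpectrum (𝓞 ↥(maximalRealSubfield L)),
      Measure ((UnitaryGroup.cmDatum L 2 (Matrix.of fun i j : Fin 2 => if i.val + j.val + 1 = 2 then (1 : L) else 0)).Local v ×
        (UnitaryGroup.cmDatum L 1 (Matrix.of fun i j : Fin 1 => if i.val + j.val + 1 = 1 then (1 : L) else 0)).Local v))
    (νG : ∀ v : HeightOneSpectrum (𝓞 ↥(maximalRealSubfield L)), Measure ((UnitaryGroup.cmDatum L 3 (qsForm L)).Local v))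
    [∀ v, (νH v).IsHaarMeasure] [∀ v, (νH v).IsMulRightInvariant] [∀ v, (νG v).IsHaarMeasure] [∀ v, (νG v).IsMulRightInvariant]
    [∀ (v : HeightOneSpectrum (𝓞 ↥(maximalRealSubfield L)))
        (a : (UnitaryGroup.cmDatum L 2 (Matrix.of fun i j : Fin 2 => if i.val + j.val + 1 = 2 then (1 : L) else 0)).Local v ×
          (UnitaryGroup.cmDatum L 1 (Matrix.of fun i j : Fin 1 => if i.val + j.val + 1 = 1 then (1 : L) else 0)).Local v),
        MeasurableSpace (((UnitaryGroup.cmDatum L 2 (Matrix.of fun i j : Fin 2 => if i.val + j.val + 1 = 2 then (1 : L) else 0)).Local v ×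
          (UnitaryGroup.cmDatum L 1 (Matrix.of fun i j : Fin 1 => if i.val + j.val + 1 = 1 then (1 : L) else 0)).Local v) ⧸
          Subgroup.centralizer ({a} : Set ((UnitaryGroup.cmDatum L 2 (Matrix.of fun i j : Fin 2 => if i.val + j.val + 1 = 2 then (1 : L) else 0)).Local v ×
          (UnitaryGroup.cmDatum L 1 (Matrix.of fun i j : Fin 1 => if i.val + j.val + 1 = 1 then (1 : L) else 0)).Local v)))]
    [∀ (v : HeightOneSpectrum (𝓞 ↥(maximalRealSubfield L)))
        (a : (UnitaryGroup.cmDatum L 2 (Matrix.of fun i j : Fin 2 => if i.val + j.val + 1 = 2 then (1 : L) else 0)).Local v ×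
          (UnitaryGroup.cmDatum L 1 (Matrix.of fun i j : Fin 1 => if i.val + j.val + 1 = 1 then (1 : L) else 0)).Local v),
        BorelSpace (((UnitaryGroup.cmDatum L 2 (Matrix.of fun i j : Fin 2 => if i.val + j.val + 1 = 2 then (1 : L) else 0)).Local v ×
          (UnitaryGroup.cmDatum L 1 (Matrix.of fun i j : Fin 1 => if i.val + j.val + 1 = 1 then (1 : L) else 0)).Local v) ⧸
          Subgroup.centralizer ({a} : Set ((UnitaryGroup.cmDatum L 2 (Matrix.of fun i j : Fin 2 => if i.val + j.val + 1 = 2 then (1 : L) else 0)).Local v ×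
          (UnitaryGroup.cmDatum L 1 (Matrix.of fun i j : Fin 1 => if i.val + j.val + 1 = 1 then (1 : L) else 0)).Local v)))]
    [∀ (v : HeightOneSpectrum (𝓞 ↥(maximalRealSubfield L))) (γ : (UnitaryGroup.cmDatum L 3 (qsForm L)).Local v),
        MeasurableSpace ((UnitaryGroup.cmDatum L 3 (qsForm L)).Local v ⧸ Subgroup.centralizer ({γ} : Set ((UnitaryGroup.cmDatum L 3 (qsForm L)).Local v)))]
    [∀ (v : HeightOneSpectrum (𝓞 ↥(maximalRealSubfield L))) (γ : (UnitaryGroup.cmDatum L 3 (qsForm L)).Local v),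
        BorelSpace ((UnitaryGroup.cmDatum L 3 (qsForm L)).Local v ⧸ Subgroup.centralizer ({γ} : Set ((UnitaryGroup.cmDatum L 3 (qsForm L)).Local v)))]
    (hμu : μ.IsUnitary)
    (hμω : ∀ x : ideleGroup ↥(maximalRealSubfield L), μ (AdeleRing.ideleBaseChange (↥(maximalRealSubfield L)) L x) = quadraticHeckeCharCM L x) :
    UnitFundamentalLemmaExplicit L (qsForm L) μ νH νG :=
  unitFundamentalLemmaExplicit_of_isUnit L (qsForm L) μ νH νG
    ((Matrix.isUnit_iff_isUnit_det _).2 (det_qsForm_ne_zero L).isUnit) (qsForm_map_cmConjRingHom_transpose L) hμu hμω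

end Summit.HodgeConjecture.HodgeConjecture.R90.S10

end
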